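import Literature.IUT.HodgeArakelov.BadPlaceSettingOfUnderline
import Literature.IUT.HodgeArakelov.EtaleThetaDataOfSettingThm16
import HarnessLib

/-!
# [IUTchII] Prop. 2.1 well-definedness at the [EtTh] model from the Thm. 1.6 (i) sub-DAG inputs — NO named
# FACT, NO `Π^tp_Ÿ`-stabilisation assumed (proof-only compositions)

S. Mochizuki, *Inter-universal Teichmüller theory II*, kurims manuscript (Dec. 2020) §2, Prop. 2.1
pp. 64–65 (claim key `Mochizuki2012`, DISPUTED, D-0012); S. Mochizuki, *The étale theta function …* [EtTh]
Thm. 1.6 (i) p. 17, Prop. 2.4 (i) p. 38. abc-iut cell (D-0067 wave 3 discharge), seat abc-iut-L6-d6 (gen 3);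
cone of [IUTchIII] Cor. 3.12, DAG node **IUTchII:Prop2.1** (ROUTE D of abc-iut-w4-d034's
`BadPlaceSettingOfUnderlineProp21.lean`). PROOF-ONLY: no definition, no new named fact; nothing landed is
edited.

WHAT THIS FILE DOES. abc-iut-w4-d034 / abc-iut-L6-t19 reduced "[IUTchII] Prop. 2.1 is well defined at the
model" (any two Prop. 2.1 outputs over the same topological group `P` have the same top row
`Π^tp_{Ÿ̲_v} ⊆ Π^tp_{Y̲_v} ⊆ P`) to abc-iut-L6-t1's hypothesis (H1)
`EtaleThetaDataOfSetting.PiYddCharacteristic C` (`TemperedCoverings.YL_eq_of_piYddCharacteristic(')`).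
The tree has three kernel suppliers of (H1): from the named FACT [EtTh] Cor. 2.18 (i) (abc-iut-w4-d013,
ROUTE A), from the [EtTh] Prop. 2.4 (i) extension binder `hP24` which ASSUMES the `Π^tp_Ÿ`-stabilisation of
the extension (p419393, ROUTE B), and — p420907 `EtaleThetaDataOfSetting.piYddCharacteristic_of_thm16Inputs` —
from the INPUTS of the [EtTh] Thm. 1.6 (i) sub-DAG only: a bare `K`-core extension `hext₀` of automorphisms of
`Π^tp_{X̲̲}` to `Π^tp_X` (GAP-LEDGER G-L6d6-2, absolute anabelian geometry, [AbsAnab] Lemma 2.2 — NO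
stabilisation clause), `Δ^tp_X`-stability `hΔ`, the compact-generation reading of the definition of `Z` `hZ`
(G-L6d6-1 / origin clause R1), the two K3 inputs `hK`, `hYN` (abc-iut-w5-d051's `Thm16Sub`), [AbsAnab]
Thm. 6.5 `h65` and the existence of a cuspidal decomposition group inside `Π^tp_Y` `hex`. This file composes
the third supplier with the reduction: **ROUTE D — Prop. 2.1 well-definedness at BOTH model bad-place
settings (`ofUnderline`, print-level, abc-iut-L6-t19; `ofDoubleUnderline`, `(1,1)`-ambient, abc-iut-w4-d034)
with NO named FACT and NO assumed `Π^tp_Ÿ`-stabilisation** — the `Ÿ`-row is DERIVED (via abc-iut-L6-d6's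
`map_GtpYdd_eq_of_thm16Inputs`, p420155, i.e. [EtTh] Thm. 1.6 (i) at the model from its sub-DAG inputs).

[claim: Mochizuki2012, status: disputed] Nothing here takes a side on [IUTchIII] Cor. 3.12; nothing asserts
[EtTh] Thm. 1.6, Prop. 2.4 or Cor. 2.18; the binders are hypotheses, recorded in the cell's GAP-LEDGER;
typed ≠ proved.
-/

noncomputable section

namespace Literature.IUT.HodgeArakelov

open Literature.AnabelianGeometry.EtaleTheta

namespace BadPlaceSetting

variable {p : ℕ} [Fact p.Prime] {D : Literature.AnabelianGeometry.EtaleTheta.ThetaSetting p}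
  {E : D.EtaleThetaData} {l : ℕ} (C : E.DoubleUnderline l) {N : ℕ+} (μ : D.CyclotomeMod l N)
  (hC : D.Compat) (hS : D.Sec2Hyps) (hl : l.Prime) (hp2 : p ≠ 2) (hpl : p ≠ l)
  (hζ : ∃ ζ : D.K, IsPrimitiveRoot ζ (4 * l))
  {η : (C.thetaEnvData μ hC hS).PiYdd → MuN p N} (hη : η ∈ (C.thetaEnvData μ hC hS).thetaCocycles)
  (hext₀ : ∀ γ : C.Huu ≃ₜ* C.Huu, ∃ Γ : D.PiTemp ≃ₜ* D.PiTemp,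
    ∀ h : C.Huu, Γ (h : D.PiTemp) = ((γ h : C.Huu) : D.PiTemp))
  (hΔ : ∀ Γ : D.PiTemp ≃ₜ* D.PiTemp, D.DeltaTemp.map Γ.toMulEquiv.toMonoidHom = D.DeltaTemp)
  (hZ : Thm16Sub.KerToZIsCompactlyGenerated D) (hK : Thm16Sub.GKNIsKernelOfAction D 2)
  (hYN : Thm16Sub.GtpYNFromCusp D 2) (h65 : D.IsoPreservesCuspidalDecomp D.toTemperedCurve)
  (hex : ∃ Dc : Subgroup D.PiTemp, D.IsCuspidalDecompositionGroup Dc ∧ Dc ≤ D.GtpY)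

include hext₀ hΔ hZ hK hYN h65 hex

/-- Both anabelian hypotheses `hY`, `hYdd` of abc-iut-w4-d010's `TemperedCoverings.YL_eq_of_characteristic`
hold at the PRINT-LEVEL model bad-place setting `ofUnderline` from the [EtTh] Thm. 1.6 (i) sub-DAG inputs
alone (binders `hext₀ hΔ hZ hK hYN h65 hex`; NO named FACT, NO assumed `Π^tp_Ÿ`-stabilisation):
abc-iut-L6-t19's `isTopCharacteristic_refY_refYdd_ofUnderline` ∘ p420907
`EtaleThetaDataOfSetting.piYddCharacteristic_of_thm16Inputs`. DAG node IUTchII:Prop2.1, ROUTE D.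
[claim: Mochizuki2012, status: disputed] (IUTchII §2 Prop 2.1, kurims p.65) -/
theorem isTopCharacteristic_refY_refYdd_ofUnderline_of_thm16Inputs :
    IsTopCharacteristic (ofUnderline C μ hC hS hl hp2 hpl hζ hη).PiX
        ((ofUnderline C μ hC hS hl hp2 hpl hζ hη).refY.comap
          (ofUnderline C μ hC hS hl hp2 hpl hζ hη).inclPlain) ∧
      IsTopCharacteristic (ofUnderline C μ hC hS hl hp2 hpl hζ hη).PiX
        ((ofUnderline C μ hC hS hl hp2 hpl hζ hη).refYdd.comap
          (ofUnderline C μ hC hS hl hp2 hpl hζ hη).inclPlain) :=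
  isTopCharacteristic_refY_refYdd_ofUnderline C μ hC hS hl hp2 hpl hζ hη
    (EtaleThetaDataOfSetting.piYddCharacteristic_of_thm16Inputs C hext₀ hΔ hZ hK hYN h65 hex)

/-- The same at the `(1,1)`-ambient variant `ofDoubleUnderline` (abc-iut-w4-d034's
`isTopCharacteristic_refY_refYdd_ofDoubleUnderline` ∘ p420907). DAG node IUTchII:Prop2.1, ROUTE D.
[claim: Mochizuki2012, status: disputed] (IUTchII §2 Prop 2.1, kurims p.65) -/
theorem isTopCharacteristic_refY_refYdd_ofDoubleUnderline_of_thm16Inputs :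
    IsTopCharacteristic (ofDoubleUnderline C μ hC hS hl hp2 hpl hζ hη).PiX
        ((ofDoubleUnderline C μ hC hS hl hp2 hpl hζ hη).refY.comap
          (ofDoubleUnderline C μ hC hS hl hp2 hpl hζ hη).inclPlain) ∧
      IsTopCharacteristic (ofDoubleUnderline C μ hC hS hl hp2 hpl hζ hη).PiX
        ((ofDoubleUnderline C μ hC hS hl hp2 hpl hζ hη).refYdd.comap
          (ofDoubleUnderline C μ hC hS hl hp2 hpl hζ hη).inclPlain) :=
  isTopCharacteristic_refY_refYdd_ofDoubleUnderline C μ hC hS hl hp2 hpl hζ hη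
    (EtaleThetaDataOfSetting.piYddCharacteristic_of_thm16Inputs C hext₀ hΔ hZ hK hYN h65 hex)

/-- **[IUTchII] Prop. 2.1, well-definedness at the PRINT-LEVEL model (`Π^tp_{X_v} := Π^tp_{X̲_v}`,
abc-iut-L6-t19's `BadPlaceSetting.ofUnderline`) from the [EtTh] Thm. 1.6 (i) sub-DAG inputs — ROUTE D, NO
named FACT, NO assumed `Π^tp_Ÿ`-stabilisation** ("may be reconstructed … from `Π^tp_{X̲̲_v}`", kurims
p. 65): any two Prop. 2.1 outputs over the same topological group `P` have the same top row
`Π^tp_{Ÿ̲_v} ⊆ Π^tp_{Y̲_v} ⊆ P`, granted only the binders `hext₀` (G-L6d6-2, bare `K`-core extension), `hΔ`,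
`hZ` (G-L6d6-1 / R1), `hK`, `hYN` (K3), `h65`, `hex`. Compare ROUTE A `TemperedCoverings.YL_eq_of_cor218_i'`
(named FACT [EtTh] Cor. 2.18 (i)) and ROUTE B `TemperedCoverings.YL_eq_of_prop24Model'` (binder `hP24`, which
assumes the `Π^tp_Ÿ`-clause this route derives).
[claim: Mochizuki2012, status: disputed] (IUTchII §2 Prop 2.1, kurims p.65) -/
theorem _root_.Literature.IUT.HodgeArakelov.TemperedCoverings.YL_eq_of_thm16Inputs' {P : TopGroup.{0}}
    (T₁ T₂ : TemperedCoverings (ofUnderline C μ hC hS hl hp2 hpl hζ hη) P) :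
    T₁.YL = T₂.YL ∧ T₁.YddL = T₂.YddL :=
  TemperedCoverings.YL_eq_of_piYddCharacteristic' C μ hC hS hl hp2 hpl hζ hη
    (EtaleThetaDataOfSetting.piYddCharacteristic_of_thm16Inputs C hext₀ hΔ hZ hK hYN h65 hex) T₁ T₂

/-- **[IUTchII] Prop. 2.1, well-definedness at the `(1,1)`-ambient model variant `ofDoubleUnderline` from the
[EtTh] Thm. 1.6 (i) sub-DAG inputs — ROUTE D** (abc-iut-w4-d034's
`TemperedCoverings.YL_eq_of_piYddCharacteristic` ∘ p420907). Same binders, NO named FACT.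
[claim: Mochizuki2012, status: disputed] (IUTchII §2 Prop 2.1, kurims p.65) -/
theorem _root_.Literature.IUT.HodgeArakelov.TemperedCoverings.YL_eq_of_thm16Inputs {P : TopGroup.{0}}
    (T₁ T₂ : TemperedCoverings (ofDoubleUnderline C μ hC hS hl hp2 hpl hζ hη) P) :
    T₁.YL = T₂.YL ∧ T₁.YddL = T₂.YddL :=
  TemperedCoverings.YL_eq_of_piYddCharacteristic C μ hC hS hl hp2 hpl hζ hη
    (EtaleThetaDataOfSetting.piYddCharacteristic_of_thm16Inputs C hext₀ hΔ hZ hK hYN h65 hex) T₁ T₂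

end BadPlaceSetting

end Literature.IUT.HodgeArakelov

end
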